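import Summits.AtomisticToContinuum.Crystallization.Theorems.OverbindingBudgetLimitChargeFreeBall

/-!
# OverbindingBudget — the RT-DICTIONARY: at a charge-free site of a clean texture the `1/100`-bond star IS the `RT` contact shell (lens-4 g28, part XI)

Helper file (`--supports stmt-AtomisticToContinuum-31280`; critic row 422, g29 ORDER (b) «RT-DICTIONARY lemma, pure metric
bookkeeping»).  The certificate target `LocalTwoShellRigidity T₀ D` (part IXa) speaks two currencies: the COMBINATORIAL one of
`ChargedEnergyGap` (the scale-free `1/100`-bond graph of a chunk: `IsChargeFree` = twelve bonds, every bond in exactly four rings) and the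
METRIC one of `CleanClass` (`RT a T₀`: twelve sites within `a(1 + 1/50) + T₀`, nothing else below `a(63/50) − T₀`).  This file proves
that at a `2`-deep charge-free chunk site of a texture all of whose sites pass `RT a T` (`47/50 ≤ a ≤ 1`, `0 ≤ T ≤ 1/250`) the two agree:

* `neighborSet_eq_shellIdx` (§2): the bond star of `i` is EXACTLY the set of chunk indices of the `RT` contact shell of `y i`
  (bonds are `≤ (1 + 1/100)·nn_i ≤ 1.0302a + 1.01T < a(63/50) − T`, so they fall in the shell by the `RT` dichotomy; the shell has exactly
  twelve members because it sits inside the gap ball, which has at most twelve; a twelve-element subset of a twelve-element finite set is all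
  of it);
* `gappedDozen_of_chargeFree` (§3): consequently the purely METRIC datum `GappedChargeFreeDozen a T Y (y i)` holds — the contact shell of
  `y i` has twelve members and each member has exactly four shell-mates within contact range (ring number four, read through the
  dictionary at the site and at the neighbour);
* `localTwoShellRigidity_of_gapped` (§4): **`GappedDozenRigidity T₀ → LocalTwoShellRigidity T₀ D`** for `0 ≤ T₀ ≤ 1/250` — the
  certificate may now be stated and run on METRIC data alone: `GappedDozenRigidity T₀` says that a site `q` of a set `Y` all of whose
  sites pass `RT a T₀` (window-or-gap separation of every pair), whose own dozen and whose twelve neighbours' dozens are gapped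
  charge-free dozens, is `(3/50, gap 1/500, 9/10, 1)`-two-shell-good.  [= GRAPH-ID ∧ KR2-LOCAL ∧ caps, in census / lens-5 vocabulary;
  UNDECIDED·TRUE-type, certificate-class; the `RT` spread `±(2 % + T₀)` is the honest tolerance input — see the ASK of 10:29Z.] [piece]
* `rdef_of_grossU_doorPeriodic_gapped` (§4): the RDEF cone with `GappedDozenRigidity (1/250)` in the rigidity slot.
-/

namespace Summit.AtomisticToContinuum.Crystallization.Theorems.OverbindingBudgetRTDictionary

open scoped Classical
open Literature.Geometry.DiscreteGeometry (IsChargeFree bondGraph nearestDist ringNumber mem_neighborSet_bondGraph nearestDist_le_dist)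
open Summit.AtomisticToContinuum.Crystallization.Theses.OverbindingBudget (RobustDefectLimitWindows)
open Summit.AtomisticToContinuum.Crystallization.Theses.PricedLinkCensus (ChargedEnergyGap)
open Summit.AtomisticToContinuum.Crystallization.Theorems.OverbindingBudgetGradedBareness (CleanlessExcessT)
open Summit.AtomisticToContinuum.Crystallization.Theorems.OverbindingBudgetCoherentCut (CoherentResidual)
open Summit.AtomisticToContinuum.Crystallization.Theorems.OverbindingBudgetUniformCutStatements (GrossCleanBallsU)
open Summit.AtomisticToContinuum.Crystallization.Theorems.OverbindingBudgetViolatorDensityFloor (RT)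
open Summit.AtomisticToContinuum.Crystallization.Theorems.OverbindingBudgetEdgeRelaxationStatements (CleanClass)
open Summit.AtomisticToContinuum.Crystallization.Theorems.OverbindingBudgetElasticSplitScale (HasCompressedScale CompressedVirialLaw)
open Summit.AtomisticToContinuum.Crystallization.Theorems.OverbindingBudgetElasticSplitPeriodic (PeriodicStrainedCubes)
open Summit.AtomisticToContinuum.Crystallization.Theorems.OverbindingBudgetElasticSplitDoorBridge (CleanCharted rdef_of_grossU_doorPeriodic)
open Summit.AtomisticToContinuum.Crystallization.Theorems.ChartedPlanarOrderDoorLayered (DoorPeriodic)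
open Summit.AtomisticToContinuum.Crystallization.Theorems.OverbindingBudgetTwoShellTransfer (IsTwoShellGoodSetGap LocalTwoShellRigidity
  cleanTwoShell_of_ballPieces chargeFreeBallRigidity_of_local)
open Summit.AtomisticToContinuum.Crystallization.Theorems.OverbindingBudgetLimitChargeFreeBall (limitChargeFreeBall_holds)

/-! ## §1 The two shells: chunk indices and sites -/

/-- The chunk indices of the `RT` contact shell of `y i`: the other chunk sites within `a(1 + 1/50) + T`. -/
def shellIdx (a T : ℝ) {N : ℕ} (y : Fin N → EuclideanSpace ℝ (Fin 3)) (i : Fin N) : Set (Fin N) :=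
  {j | j ≠ i ∧ dist (y i) (y j) ≤ a * (1 + 1 / 50) + T}

/-- The `RT` contact shell of the site `q` in `Y` (verbatim the set of `RT`'s second clause). -/
def shellY (a T : ℝ) (Y : Set (EuclideanSpace ℝ (Fin 3))) (q : EuclideanSpace ℝ (Fin 3)) : Set (EuclideanSpace ℝ (Fin 3)) :=
  {w ∈ Y | w ≠ q ∧ dist q w ≤ a * (1 + 1 / 50) + T}

/-- **The metric datum.** `q` has a GAPPED CHARGE-FREE DOZEN in `Y` at spacing `a`, tolerance `T`: its `RT` contact shell has exactly
twelve members, and every member has exactly four shell-mates of `q` within its own contact range. -/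
def GappedChargeFreeDozen (a T : ℝ) (Y : Set (EuclideanSpace ℝ (Fin 3))) (q : EuclideanSpace ℝ (Fin 3)) : Prop :=
  (shellY a T Y q).ncard = 12 ∧ ∀ p ∈ shellY a T Y q, (shellY a T Y q ∩ shellY a T Y p).ncard = 4

/-- **The metric certificate target** (slot 4 of the RDEF cone): in a set all of whose sites pass `RT a T₀` (`47/50 ≤ a ≤ 1`), a site
whose dozen and whose neighbours' dozens are gapped charge-free dozens is `(3/50, gap 1/500, 9/10, 1)`-two-shell-good.
[GRAPH-ID ∧ KR2-LOCAL ∧ caps; UNDECIDED·TRUE-type, certificate-class.] [piece] -/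
def GappedDozenRigidity (T₀ : ℝ) : Prop :=
  ∀ (a : ℝ) (Y : Set (EuclideanSpace ℝ (Fin 3))) (q : EuclideanSpace ℝ (Fin 3)), 47 / 50 ≤ a → a ≤ 1 → q ∈ Y →
    (∀ w ∈ Y, RT a T₀ Y w) → GappedChargeFreeDozen a T₀ Y q → (∀ p ∈ shellY a T₀ Y q, GappedChargeFreeDozen a T₀ Y p) →
    IsTwoShellGoodSetGap (3 / 50) (1 / 500) (9 / 10) 1 Y q

/-! ## §2 The dictionary -/

section Chunk

variable {Y : Set (EuclideanSpace ℝ (Fin 3))} {c : EuclideanSpace ℝ (Fin 3)} {ℓ a T : ℝ} {N : ℕ}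
  {y : Fin N → EuclideanSpace ℝ (Fin 3)} {i : Fin N}

/-- A site of `Y` within distance `< 2` of a `2`-deep chunk site is a chunk site. [this file] -/
theorem exists_eq_of_dist_lt_two (hr : Set.range y = Y ∩ {z | ∀ j : Fin 3, c j ≤ z j ∧ z j < c j + ℓ})
    (hdeep : ∀ j : Fin 3, c j + 2 ≤ y i j ∧ y i j + 2 ≤ c j + ℓ) {w : EuclideanSpace ℝ (Fin 3)} (hw : w ∈ Y) (hd : dist (y i) w < 2) :
    ∃ k, y k = w := by
  have hmem : w ∈ Set.range y := by
    rw [hr]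
    refine ⟨hw, fun j => ?_⟩
    have h : |y i j - w j| ≤ dist (y i) w := by
      rw [← Real.dist_eq]; exact PiLp.dist_apply_le (y i) w j
    have hlt : |y i j - w j| < 2 := lt_of_le_of_lt h hd
    have h'' := abs_lt.1 hlt
    obtain ⟨h1, h2⟩ := hdeep j
    constructor <;> linarith [h''.1, h''.2]
  exact hmem

/-- Chunk sites are sites of `Y`. [this file] -/
theorem mem_of_range (hr : Set.range y = Y ∩ {z | ∀ j : Fin 3, c j ≤ z j ∧ z j < c j + ℓ}) (k : Fin N) : y k ∈ Y := by
  have h := Set.mem_range_self (f := y) k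
  rw [hr] at h
  exact h.1

/-- The chunk image of the index shell is the site shell (at a `2`-deep site, `a ≤ 1`, `T ≤ 1/250`). [this file] -/
theorem image_shellIdx (hy : Function.Injective y) (hr : Set.range y = Y ∩ {z | ∀ j : Fin 3, c j ≤ z j ∧ z j < c j + ℓ})
    (hdeep : ∀ j : Fin 3, c j + 2 ≤ y i j ∧ y i j + 2 ≤ c j + ℓ) (ha1 : a ≤ 1) (hT : T ≤ 1 / 250) :
    y '' shellIdx a T y i = shellY a T Y (y i) := by
  ext w
  constructor
  · rintro ⟨j, ⟨hji, hd⟩, rfl⟩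
    exact ⟨mem_of_range hr j, hy.ne hji, hd⟩
  · rintro ⟨hw, hne, hd⟩
    obtain ⟨k, rfl⟩ := exists_eq_of_dist_lt_two hr hdeep hw (by linarith)
    exact ⟨k, ⟨fun h => hne (congrArg y h), hd⟩, rfl⟩

/-- In a texture passing `RT a T` at `y i`, the contact shell of a `2`-deep chunk site has exactly twelve members. [this file] -/
theorem ncard_shellY_eq (hr : Set.range y = Y ∩ {z | ∀ j : Fin 3, c j ≤ z j ∧ z j < c j + ℓ})
    (hdeep : ∀ j : Fin 3, c j + 2 ≤ y i j ∧ y i j + 2 ≤ c j + ℓ) (ha : 47 / 50 ≤ a) (ha1 : a ≤ 1) (hT0 : 0 ≤ T) (hT : T ≤ 1 / 250)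
    (hRT : RT a T Y (y i)) : (shellY a T Y (y i)).ncard = 12 := by
  obtain ⟨hB, h12, -⟩ := hRT
  have hSB : shellY a T Y (y i) ⊆ {w ∈ Y | w ≠ y i ∧ dist (y i) w < a * (63 / 50) - T} := by
    rintro w ⟨hw, hne, hd⟩
    exact ⟨hw, hne, by linarith⟩
  have hBfin : ({w ∈ Y | w ≠ y i ∧ dist (y i) w < a * (63 / 50) - T}).Finite := by
    refine (Set.finite_range y).subset ?_
    rintro w ⟨hw, -, hd⟩
    obtain ⟨k, rfl⟩ := exists_eq_of_dist_lt_two hr hdeep hw (by linarith)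
    exact Set.mem_range_self k
  exact le_antisymm ((Set.ncard_le_ncard hSB hBfin).trans hB) h12

/-- The own nearest-neighbour distance of a `2`-deep chunk site is at most the contact radius. [this file] -/
theorem nearestDist_le_contact (hr : Set.range y = Y ∩ {z | ∀ j : Fin 3, c j ≤ z j ∧ z j < c j + ℓ})
    (hdeep : ∀ j : Fin 3, c j + 2 ≤ y i j ∧ y i j + 2 ≤ c j + ℓ) (ha1 : a ≤ 1) (hT : T ≤ 1 / 250) (hRT : RT a T Y (y i)) :
    nearestDist y i ≤ a * (1 + 1 / 50) + T := by
  obtain ⟨-, h12, -⟩ := hRT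
  have hne : ({w ∈ Y | w ≠ y i ∧ dist (y i) w ≤ a * (1 + 1 / 50) + T}).Nonempty :=
    Set.nonempty_of_ncard_ne_zero (by omega)
  obtain ⟨w, hw, hwne, hwd⟩ := hne
  obtain ⟨k, rfl⟩ := exists_eq_of_dist_lt_two hr hdeep hw (by linarith)
  have hki : k ≠ i := fun h => hwne (by rw [h])
  exact (nearestDist_le_dist y hki).trans hwd

/-- **THE DICTIONARY.** At a `2`-deep `1/100`-charge-free chunk site of a texture all of whose sites pass `RT a T`
(`47/50 ≤ a ≤ 1`, `0 ≤ T ≤ 1/250`), the bond star is exactly the index shell. [this file] -/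
theorem neighborSet_eq_shellIdx (hRT : ∀ w ∈ Y, RT a T Y w) (ha : 47 / 50 ≤ a) (ha1 : a ≤ 1) (hT0 : 0 ≤ T) (hT : T ≤ 1 / 250)
    (hy : Function.Injective y) (hr : Set.range y = Y ∩ {z | ∀ j : Fin 3, c j ≤ z j ∧ z j < c j + ℓ})
    (hdeep : ∀ j : Fin 3, c j + 2 ≤ y i j ∧ y i j + 2 ≤ c j + ℓ) (hcf : IsChargeFree (1 / 100 : ℝ) y i) :
    (bondGraph (1 / 100 : ℝ) y).neighborSet i = shellIdx a T y i := by
  have hRTi := hRT (y i) (mem_of_range hr i)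
  have hnn := nearestDist_le_contact hr hdeep ha1 hT hRTi
  have hsub : (bondGraph (1 / 100 : ℝ) y).neighborSet i ⊆ shellIdx a T y i := by
    intro j hj
    rw [mem_neighborSet_bondGraph] at hj
    obtain ⟨hij, hd⟩ := hj
    refine ⟨Ne.symm hij, ?_⟩
    have hd' : dist (y i) (y j) ≤ (1 + 1 / 100) * nearestDist y i :=
      hd.trans (mul_le_mul_of_nonneg_left (min_le_left _ _) (by norm_num))
    have hmul := mul_le_mul_of_nonneg_left hnn (by norm_num : (0 : ℝ) ≤ 1 + 1 / 100)
    have hlt : dist (y i) (y j) < a * (63 / 50) - T := by linarith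
    rcases ((hRTi.2.2 (y j) (mem_of_range hr j) (hy.ne (Ne.symm hij))).2) with h | h
    · exact h
    · linarith
  have hS12 : (shellIdx a T y i).ncard = 12 := by
    rw [← Set.ncard_image_of_injective _ hy, image_shellIdx hy hr hdeep ha1 hT, ncard_shellY_eq hr hdeep ha ha1 hT0 hT hRTi]
  exact Set.eq_of_subset_of_ncard_le hsub (by rw [hcf.1, hS12]) (Set.toFinite _)

/-- A bond at a `2`-deep site of such a texture is at most `1.0302a + 1.01T` long. [this file] -/
theorem dist_le_of_mem_neighborSet (hRT : ∀ w ∈ Y, RT a T Y w) (ha1 : a ≤ 1) (hT : T ≤ 1 / 250)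
    (hr : Set.range y = Y ∩ {z | ∀ j : Fin 3, c j ≤ z j ∧ z j < c j + ℓ})
    (hdeep : ∀ j : Fin 3, c j + 2 ≤ y i j ∧ y i j + 2 ≤ c j + ℓ) {j : Fin N} (hj : j ∈ (bondGraph (1 / 100 : ℝ) y).neighborSet i) :
    dist (y i) (y j) ≤ (1 + 1 / 100) * (a * (1 + 1 / 50) + T) := by
  rw [mem_neighborSet_bondGraph] at hj
  have hnn := nearestDist_le_contact hr hdeep ha1 hT (hRT (y i) (mem_of_range hr i))
  exact hj.2.trans ((mul_le_mul_of_nonneg_left (min_le_left _ _) (by norm_num)).trans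
    (mul_le_mul_of_nonneg_left hnn (by norm_num)))

/-- Depth propagates along short distances: a chunk site within `r` of a `(d + r)`-deep site is `d`-deep. [this file] -/
theorem deep_of_dist_le {d r : ℝ} (hdeep : ∀ j : Fin 3, c j + (d + r) ≤ y i j ∧ y i j + (d + r) ≤ c j + ℓ) {k : Fin N}
    (hk : dist (y i) (y k) ≤ r) : ∀ j : Fin 3, c j + d ≤ y k j ∧ y k j + d ≤ c j + ℓ := by
  intro j
  have hc : |y i j - y k j| ≤ dist (y i) (y k) := by
    rw [← Real.dist_eq]; exact PiLp.dist_apply_le (y i) (y k) j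
  have h := abs_le.1 (hc.trans hk)
  obtain ⟨h1, h2⟩ := hdeep j
  constructor <;> linarith [h.1, h.2]

/-! ## §3 The metric datum at a charge-free site -/

/-- **Gapped charge-free dozen from the dictionary.** At a `4`-deep chunk site that is `1/100`-charge-free together with its bond
neighbours, in a texture all of whose sites pass `RT a T`, the metric datum `GappedChargeFreeDozen a T Y (y i)` holds. [this file] -/
theorem gappedDozen_of_chargeFree (hRT : ∀ w ∈ Y, RT a T Y w) (ha : 47 / 50 ≤ a) (ha1 : a ≤ 1) (hT0 : 0 ≤ T) (hT : T ≤ 1 / 250)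
    (hy : Function.Injective y) (hr : Set.range y = Y ∩ {z | ∀ j : Fin 3, c j ≤ z j ∧ z j < c j + ℓ})
    (hdeep : ∀ j : Fin 3, c j + 4 ≤ y i j ∧ y i j + 4 ≤ c j + ℓ) (hcf : IsChargeFree (1 / 100 : ℝ) y i)
    (hcfN : ∀ j ∈ (bondGraph (1 / 100 : ℝ) y).neighborSet i, IsChargeFree (1 / 100 : ℝ) y j) :
    GappedChargeFreeDozen a T Y (y i) := by
  have hdeep2 : ∀ j : Fin 3, c j + 2 ≤ y i j ∧ y i j + 2 ≤ c j + ℓ := by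
    intro j; obtain ⟨h1, h2⟩ := hdeep j; constructor <;> linarith
  have hstar := neighborSet_eq_shellIdx hRT ha ha1 hT0 hT hy hr hdeep2 hcf
  refine ⟨ncard_shellY_eq hr hdeep2 ha ha1 hT0 hT (hRT (y i) (mem_of_range hr i)), ?_⟩
  rintro p ⟨hp, hpne, hpd⟩
  obtain ⟨j, rfl⟩ := exists_eq_of_dist_lt_two hr hdeep2 hp (by linarith)
  have hjS : j ∈ shellIdx a T y i := ⟨fun h => hpne (congrArg y h), hpd⟩
  have hjN : j ∈ (bondGraph (1 / 100 : ℝ) y).neighborSet i := by rw [hstar]; exact hjS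
  have hdeep4 : ∀ k : Fin 3, c k + (2 + 2) ≤ y i k ∧ y i k + (2 + 2) ≤ c k + ℓ := by
    intro k; obtain ⟨h1, h2⟩ := hdeep k; constructor <;> linarith
  have hdeepj : ∀ k : Fin 3, c k + 2 ≤ y j k ∧ y j k + 2 ≤ c k + ℓ := deep_of_dist_le hdeep4 (by linarith)
  have hstarj := neighborSet_eq_shellIdx hRT ha ha1 hT0 hT hy hr hdeepj (hcfN j hjN)
  have hring : ringNumber (1 / 100 : ℝ) y i j = 4 := hcf.2 j hjN
  rw [Literature.Geometry.DiscreteGeometry.ringNumber_def, hstar, hstarj] at hring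
  rw [← image_shellIdx hy hr hdeep2 ha1 hT, ← image_shellIdx hy hr hdeepj ha1 hT, ← Set.image_inter hy,
    Set.ncard_image_of_injective _ hy, hring]

end Chunk

/-! ## §4 The seam and the cone -/

set_option maxHeartbeats 800000 in
/-- **Seam, PROVED.** `GappedDozenRigidity T₀ → LocalTwoShellRigidity T₀ D` for `0 ≤ T₀ ≤ 1/250`: at a `7`-deep chunk site whose `3`-ball
is charge-free the dictionary supplies the gapped charge-free dozens at the site and at its twelve neighbours. [this file] -/
theorem localTwoShellRigidity_of_gapped {T₀ D : ℝ} (hT0 : 0 ≤ T₀) (hT : T₀ ≤ 1 / 250) (h : GappedDozenRigidity T₀) :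
    LocalTwoShellRigidity T₀ D := by
  intro Y hY _hnc c ℓ N y i hy hr hdeep hcf3
  obtain ⟨a, ha, ha1, hRT⟩ := hY.2.2.2.2.2
  have hdeep4 : ∀ j : Fin 3, c j + 4 ≤ y i j ∧ y i j + 4 ≤ c j + ℓ := by
    intro j; obtain ⟨h1, h2⟩ := hdeep j; constructor <;> linarith
  have hdeep2 : ∀ j : Fin 3, c j + 2 ≤ y i j ∧ y i j + 2 ≤ c j + ℓ := by
    intro j; obtain ⟨h1, h2⟩ := hdeep j; constructor <;> linarith
  have hcfi : IsChargeFree (1 / 100 : ℝ) y i := hcf3 i (by rw [dist_self]; norm_num)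
  -- charge-freeness of the bond neighbours of any chunk site within `1.96` of `y i`
  have hcfnbr : ∀ k : Fin N, dist (y i) (y k) ≤ 1.96 → (∀ j : Fin 3, c j + 2 ≤ y k j ∧ y k j + 2 ≤ c j + ℓ) →
      ∀ m ∈ (bondGraph (1 / 100 : ℝ) y).neighborSet k, IsChargeFree (1 / 100 : ℝ) y m := by
    intro k hk hdeepk m hm
    have hdm := dist_le_of_mem_neighborSet hRT ha1 hT hr hdeepk hm
    refine hcf3 m ?_
    have htri := dist_triangle (y m) (y k) (y i)
    rw [dist_comm (y m) (y k), dist_comm (y k) (y i)] at htri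
    nlinarith [htri, hdm, hk, ha1, hT]
  have hdoz := gappedDozen_of_chargeFree hRT ha ha1 hT0 hT hy hr hdeep4 hcfi (hcfnbr i (by rw [dist_self]; norm_num) hdeep2)
  refine h a Y (y i) ha ha1 (mem_of_range hr i) hRT hdoz ?_
  rintro p ⟨hp, hpne, hpd⟩
  obtain ⟨j, rfl⟩ := exists_eq_of_dist_lt_two hr hdeep2 hp (by linarith)
  have hdj : dist (y i) (y j) ≤ 1.96 := by linarith
  have hdeep6 : ∀ k : Fin 3, c k + (4 + 1.96) ≤ y i k ∧ y i k + (4 + 1.96) ≤ c k + ℓ := by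
    intro k; obtain ⟨h1, h2⟩ := hdeep k; constructor <;> linarith
  have hdeepj4 : ∀ k : Fin 3, c k + 4 ≤ y j k ∧ y j k + 4 ≤ c k + ℓ := deep_of_dist_le hdeep6 hdj
  have hdeepj2 : ∀ k : Fin 3, c k + 2 ≤ y j k ∧ y j k + 2 ≤ c k + ℓ := by
    intro k; obtain ⟨h1, h2⟩ := hdeepj4 k; constructor <;> linarith
  have hcfj : IsChargeFree (1 / 100 : ℝ) y j := hcf3 j (by rw [dist_comm]; linarith)
  exact gappedDozen_of_chargeFree hRT ha ha1 hT0 hT hy hr hdeepj4 hcfj (hcfnbr j hdj hdeepj2)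

/-- **RDEF cone with the METRIC rigidity piece** (every `Λ`): `GrossCleanBallsU (1/250) 10 → ChargedEnergyGap →
CompressedVirialLaw (1/250) 10 → GappedDozenRigidity (1/250) → CleanCharted (1/250) 10 → DoorPeriodic Λ →
PeriodicStrainedCubes Λ (1/250) 10 → CleanlessExcessT → CoherentResidual 10 → RobustDefectLimitWindows`. [this file] -/
theorem rdef_of_grossU_doorPeriodic_gapped (Λ : ℝ) (hG : GrossCleanBallsU (1 / 250) 10) (hCEG : ChargedEnergyGap)
    (hC : CompressedVirialLaw (1 / 250) 10) (hK : GappedDozenRigidity (1 / 250)) (h₂ : CleanCharted (1 / 250) 10) (hD : DoorPeriodic Λ)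
    (hE : PeriodicStrainedCubes Λ (1 / 250) 10) (hCE : CleanlessExcessT) (hR : CoherentResidual 10) : RobustDefectLimitWindows :=
  rdef_of_grossU_doorPeriodic Λ hG hCEG hC
    (cleanTwoShell_of_ballPieces (limitChargeFreeBall_holds (1 / 250) 10)
      (chargeFreeBallRigidity_of_local (by norm_num) (localTwoShellRigidity_of_gapped (by norm_num) (by norm_num) hK))) h₂ hD hE hCE hR

end Summit.AtomisticToContinuum.Crystallization.Theorems.OverbindingBudgetRTDictionary
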